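import Summits.QuantumFields.YangMills.Theorems.UnitScaleTiltProp7H88DoorOfH137H133
import Summits.QuantumFields.YangMills.Theorems.UnitScaleTiltProp7H133FamilyPackageAllMembers
import Summits.QuantumFields.YangMills.Theorems.UnitScaleTiltProp7H88FamilyPackage
import Summits.QuantumFields.YangMills.Theorems.UnitScaleTiltProp7GaugeProjectorGradientRowSwappedBlock
import Summits.QuantumFields.YangMills.Theorems.UnitScaleTiltProp7GreenPiBlockLettersEdition
import HarnessLib

/-!
# Route `UnitScaleTilt`, crux K1 «MinimiserStabilityRegPr» (stmt-QuantumFields-19200), EX row (4) `h88` — **(K-h88-R) THE ROW (4) `∃`-PACKAGE WITHOUT THE ROOM ANTECEDENT: S47's `h88` ROW TEXT FOR ALL MEMBERS WITH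
# L-ONLY CAP ∕ CONSTANT ∕ RATE, FROM ROWS (1)(3)'s PACKAGES (✓p776003) AND THE (c4b)-FAMILY** — the h88-DOOR ✓p775556 `Prop7H88DoorOfH137H133.h88_family_of_h137k_h133_c4w` fed BY NAME
# with px10's ROOM-FREE K6-h133-R `Prop7H133FamilyPackageAllMembers.h133_family_exists_allMembers`∕`h137kpi_family_exists_allMembers` (✓p777131's re-run, ROOM line deleted from thread, antecedents and conclusion — S49 socket), the (γ) package ✓`Prop7OneFormCoerciveHolds.hco_DeltaPiSlotP_exists`, and ONE displayed
# `∃`-package `hC4b` = the BLOCK-SUPPORTED family edition of (c4) (✓p775668 `hc4b_of_letters`' text at every member; px5 g15's (c4)-FAMILY), read as the door's weighted letter by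
# D3's abstract ✓`Prop7GreenPiBlockLettersEdition.weighted_of_blockSupported` (block at rate `δ₄` ⟹ weighted at every rate `≤ δ₄∕2`, `×(2(1+2∕δ₄))³`).  ★p1 g28 CHAIR CLAIM 14:49Z.

Cell `ym3-torus` (HUMAN RULING D-0037; rung R3 = SU(2) YM₃ on T³ — NOT d = 4, NOT infinite volume, NOT a mass gap, NOT Clay).  Fleet lead ∕ chair seat `ym-ust-19200-p1` (gen 28).
THEOREMS ONLY (0 `def`, 0 `sorry`, default heartbeats — §2 measured inside 100 000); `--supports stmt-QuantumFields-19200 --as helper`; count-neutral.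

WHAT IS PROVED (ns `…Theorems.Prop7H88FamilyPackage`).
* ★★★ **`h88_family_exists_allMembers_of_c4bFamily`** — `(hC4b : ∃ αC C₄ δ₄, … ∀ L>1 i U₀ ρ, RegPr → ρ ≤ αC L → Lift → ∀ a′ ≥ 0, ⟨(c4b) text at (C₄ L, δ₄ L)⟩)` (R2 ✓`hc2b_family_allMembers`' shape with the
  (c4) operator `D_{U₀}(R_S(G′ᴾ_{a′}(toL2S v)))`) ⟹ `∃ (αΔ CΔ δΔ : ℕ → ℝ), (0 < αΔ L) ∧ (10¹²L³αΔ ≤ 1) ∧ (10¹⁰L⁶αΔ ≤ 1) ∧ (13·10¹⁴L³αΔ ≤ 1) ∧ (αΔ ≤ 1) ∧ (0 ≤ CΔ L) ∧ (0 < δΔ L) ∧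
  ∀ L>1 i U₀ ρ, RegPr → ρ ≤ αΔ L → Lift → ∀ a ∈ [a₀,a₁]·(c₀ L∕cB L)ℓ³ → ⟨S47's `h88` ROW TEXT at (CΔ L, δΔ L)⟩` — `h133_family_exists_allMembers`' `∃`-head and antecedent order VERBATIM (NO ROOM line).
* ★★★ **`h88_family_exists_allMembers`** — the same, CLOSED: fed ✓(C4b) `hc4b_family` at `am := 1`.
HYP-SAT (★★OWNER RULING №42).  `hC4b` is a displayed `∃`-package whose member text is ✓p775668 `hc4b_of_letters`' conclusion (supplier: px5 g15's (c4)-PIN∕MEMBER∕FAMILY over ✓W5a, ✓R1∕R2 §1,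
✓p775628 `hsrcW_pin`); rows (1)(3) and (γ) are TREE packages; ROOM rides only on rows (1)(3)'s packages (η-interpolant wrap; (R6) px5 removes it and this file re-runs two tokens lighter).
HONEST SCOPE.  Packaging of landed doors; CONDITIONAL on `hC4b`; nothing of (c4)'s pin, h88's print content, the other EX rows, EX or the crux is proved here; the Yang–Mills mass gap is NOT proved.

References: T. Bałaban, CMP **102** (1985) 277–309 [Balaban1985Variational] ((88) p.291, (137)–(139) pp.298–299); CMP **99** (1985) 389–434 [Balaban1985BackgroundPropagators]
((3.117) p.419, (3.133) p.422, Thm 3.12 p.423, (3.25) p.394).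
-/

set_option autoImplicit false

noncomputable section

open scoped BigOperators Matrix.Norms.L2Operator InnerProductSpace ComplexConjugate

namespace Summit.QuantumFields.YangMills.Theorems.Prop7H88FamilyPackageAllMembers

open Literature.MathematicalPhysics.QuantumFieldTheory.Balaban1983to89
open Literature.MathematicalPhysics.QuantumFieldTheory.Balaban1983to89.T3ContinuumYM3Torus
open Literature.MathematicalPhysics.QuantumFieldTheory.Balaban1983to89.T3Thm1Carrier
open Literature.MathematicalPhysics.QuantumFieldTheory.Balaban1983to89.B9Eq3119DeltaPiCarrier (currentCLM)
open T3PrintedRegularMinimiser (RegPr)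
open T3PrintedMinimiserExistence (regPr_mono)
open T3PrintedRegularOrbits (sites_eq)
open T3LevelShift (siteShift)
open T3SectALandauChart (bgUnits)
open B15DeterminingSets (embIter)
open B9SectCLatticeCarrier (Bond)
open B9Eq311L2Pairing (WL2)
open B11Eq103H1Complex (BondL2K)
open B11Eq115Space (NegSize Space115 JetSup NegSup levWeight)
open B11Eq111FrakG (nabla115)
open B11Eq90V0primeCurrent (flat115)
open B5Eq118OneStroke (iterBlockOf)
open Summit.QuantumFields.YangMills.Theorems.Prop8Chart (emlIterU)
open Summit.QuantumFields.YangMills.Theorems.Prop7SectET3Transport (periodsT3 bondEquiv bgOfCfg)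
open Summit.QuantumFields.YangMills.Theorems.Prop7SectET3HilbertLetters (W₂ frobEquiv toL2 toL2S toL2B DL2)
open Summit.QuantumFields.YangMills.Theorems.Prop7SectET3GaugeProjector (RS)
open Summit.QuantumFields.YangMills.Theorems.Prop7SectET3WilsonHessian (DeltaEtaSlot)
open Summit.QuantumFields.YangMills.Theorems.Prop7SectET3CurvedPropagators (Qk KinvT H1f PosOnto)
open Summit.QuantumFields.YangMills.Theorems.Prop7SectET3DeltaPiPInv (GprimeP DeltaPiSlotP)
open Summit.QuantumFields.YangMills.Theorems.Prop7OneFormCoerciveHolds (hco_DeltaPiSlotP_exists posOnto_of_coercive)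
open Summit.QuantumFields.YangMills.Theorems.Prop7H133FamilyPackageAllMembers (h133_family_exists_allMembers h137kpi_family_exists_allMembers)
open Summit.QuantumFields.YangMills.Theorems.Prop7H88FamilyPackage (hc4w_of_hc4b)
open Summit.QuantumFields.YangMills.Theorems.Prop7GaugeProjectorGradientRowSwappedBlock (hc4b_family)
open Summit.QuantumFields.YangMills.Theorems.Prop7GreenPiBlockLettersEdition (weighted_of_blockSupported)
open Summit.QuantumFields.YangMills.Theorems.Prop7H88DoorOfH137H133 (h88_family_of_h137k_h133_c4w)

/-! ## ★★★ The row (4) `∃`-package WITHOUT the ROOM antecedent -/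

/-- ★★★ **THE S47 ROW `h88` FOR ALL MEMBERS AS ONE `∃`-PACKAGE, MODULO THE (c4b)-FAMILY** (cap `αΔ`, constant `CΔ L`, rate `δΔ L`; thread `Lift ∧ ROOM ∧` coupling window — the `∃`-head and
antecedents of ✓`h133_family_exists` VERBATIM): h88-DOOR ✓p775556 §3 ∘ {✓`h133_family_exists`, ✓`h137kpi_family_exists`, (γ) ✓`hco_DeltaPiSlotP_exists`, `hC4b` via §1}, rates aligned to
`δΔ := min (min δK (δH∕2)) (δ₄∕2)`. [cite: Balaban1985Variational, (88) p.291, (137)–(138) pp.298–299; Balaban1985BackgroundPropagators, (3.117) p.419, (3.133) p.422, Thm 3.12 p.423] -/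
theorem h88_family_exists_allMembers_of_c4bFamily [hFL : ∀ F : T3Family, Fact (0 < (F.L : ℝ))] [hFη : ∀ (F : T3Family) (k : ℕ), Fact (0 < ((F.L : ℝ)⁻¹) ^ k)]
    (c₀ cB : ℕ → ℝ) [hc₀ : ∀ L : ℕ, Fact (0 < c₀ L)] [hcB : ∀ L : ℕ, Fact (0 < cB L)] {a₀ a₁ : ℝ} (ha₀ : 0 < a₀) (ha₀₁ : a₀ ≤ a₁)
    (hC4b : ∃ αC C₄ δ₄ : ℕ → ℝ,
      (∀ L : ℕ, 1 < L → 0 < αC L ∧ 10 ^ 12 * (L : ℝ) ^ 3 * αC L ≤ 1) ∧ (∀ L : ℕ, 1 < L → 0 ≤ C₄ L) ∧ (∀ L : ℕ, 0 < δ₄ L) ∧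
      ∀ (L : ℕ), 1 < L → ∀ (i : Idx L) (U₀ : GaugeField (i.1.1.P i.1.2.2) 0 (Matrix.specialUnitaryGroup (Fin 2) ℂ)), ∀ ρ : ℝ,
        RegPr i.1.1 i.1.2.1 i.1.2.2 ρ U₀ → ρ ≤ αC L →
      (∀ cf : Site (i.1.1.P i.1.2.2) (i.1.2.2 - i.1.2.1) → Matrix (Fin 2) (Fin 2) ℂ,
      (∀ e : PBond (i.1.1.P i.1.2.2) (i.1.2.2 - i.1.2.1), cf e.src = ((emlIterU (i.1.2.2 - i.1.2.1) (bgUnits i.1.1 i.1.2.2 U₀) e : (Matrix (Fin 2) (Fin 2) ℂ)ˣ) : Matrix (Fin 2) (Fin 2) ℂ) * cf e.tgt *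
        (((emlIterU (i.1.2.2 - i.1.2.1) (bgUnits i.1.1 i.1.2.2 U₀) e)⁻¹ : (Matrix (Fin 2) (Fin 2) ℂ)ˣ) : Matrix (Fin 2) (Fin 2) ℂ)) →
      ∃ l₀ : Site (i.1.1.P i.1.2.2) 0 → Matrix (Fin 2) (Fin 2) ℂ,
        (∀ b : PBond (i.1.1.P i.1.2.2) 0, l₀ b.src = ((bgUnits i.1.1 i.1.2.2 U₀ b : (Matrix (Fin 2) (Fin 2) ℂ)ˣ) : Matrix (Fin 2) (Fin 2) ℂ) * l₀ b.tgt * (((bgUnits i.1.1 i.1.2.2 U₀ b)⁻¹ : (Matrix (Fin 2) (Fin 2) ℂ)ˣ) : Matrix (Fin 2) (Fin 2) ℂ)) ∧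
        ∀ y : Site (i.1.1.P i.1.2.2) (i.1.2.2 - i.1.2.1), l₀ (embIter (i.1.2.2 - i.1.2.1) y) = cf y) →
        ∀ a' : ℝ, 0 ≤ a' →
          ∀ (v : Site (i.1.1.P i.1.2.2) 0 → Matrix (Fin 2) (Fin 2) ℂ) (z : Site (i.1.1.P i.1.2.2) (i.1.2.2 - i.1.2.1)), (∀ y, v y ≠ 0 → iterBlockOf (i.1.2.2 - i.1.2.1) y = z) →
            ∀ m : ℝ, 0 ≤ m → (∀ y, ‖v y‖ ≤ m) →
              ∀ b : PBond (i.1.1.P i.1.2.2) 0, ‖(toL2 i.1.1 i.1.2.2 (c₀ L)).symm (DL2 i.1.1 i.1.2.1 i.1.2.2 (c₀ L) U₀ (RS i.1.1 i.1.2.1 i.1.2.2 i.2.2.le (c₀ L) (cB L) U₀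
                  (GprimeP i.1.1 i.1.2.1 i.1.2.2 i.2.2.le (c₀ L) (cB L) a' U₀ (toL2S i.1.1 i.1.2.2 (c₀ L) v)))) b‖
                ≤ m * C₄ L * Real.exp (-(δ₄ L * (Site.tdist (P := i.1.1.P i.1.2.2) (iterBlockOf (i.1.2.2 - i.1.2.1) b.src) z : ℝ)))) :
    ∃ (αΔ CΔ δΔ : ℕ → ℝ),
      (∀ L : ℕ, 1 < L → 0 < αΔ L) ∧ (∀ L : ℕ, 1 < L → 10 ^ 12 * (L : ℝ) ^ 3 * αΔ L ≤ 1) ∧ (∀ L : ℕ, 1 < L → 10 ^ 10 * (L : ℝ) ^ 6 * αΔ L ≤ 1) ∧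
      (∀ L : ℕ, 1 < L → 13 * 10 ^ 14 * (L : ℝ) ^ 3 * αΔ L ≤ 1) ∧ (∀ L : ℕ, 1 < L → αΔ L ≤ 1) ∧ (∀ L : ℕ, 1 < L → 0 ≤ CΔ L) ∧ (∀ L : ℕ, 1 < L → 0 < δΔ L) ∧
    ∀ (L : ℕ), 1 < L → ∀ (i : Idx L) (U₀ : GaugeField (i.1.1.P i.1.2.2) 0 (Matrix.specialUnitaryGroup (Fin 2) ℂ)), ∀ ρ : ℝ, RegPr i.1.1 i.1.2.1 i.1.2.2 ρ U₀ → ρ ≤ αΔ L →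
        (∀ cf : Site (i.1.1.P i.1.2.2) (i.1.2.2 - i.1.2.1) → Matrix (Fin 2) (Fin 2) ℂ,
        (∀ e' : PBond (i.1.1.P i.1.2.2) (i.1.2.2 - i.1.2.1), cf e'.src = ((emlIterU (i.1.2.2 - i.1.2.1) (bgUnits i.1.1 i.1.2.2 U₀) e' : (Matrix (Fin 2) (Fin 2) ℂ)ˣ) : Matrix (Fin 2) (Fin 2) ℂ) * cf e'.tgt *
        (((emlIterU (i.1.2.2 - i.1.2.1) (bgUnits i.1.1 i.1.2.2 U₀) e')⁻¹ : (Matrix (Fin 2) (Fin 2) ℂ)ˣ) : Matrix (Fin 2) (Fin 2) ℂ)) →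
        ∃ l₀ : Site (i.1.1.P i.1.2.2) 0 → Matrix (Fin 2) (Fin 2) ℂ,
        (∀ b' : PBond (i.1.1.P i.1.2.2) 0, l₀ b'.src = ((bgUnits i.1.1 i.1.2.2 U₀ b' : (Matrix (Fin 2) (Fin 2) ℂ)ˣ) : Matrix (Fin 2) (Fin 2) ℂ) * l₀ b'.tgt * (((bgUnits i.1.1 i.1.2.2 U₀ b')⁻¹ : (Matrix (Fin 2) (Fin 2) ℂ)ˣ) : Matrix (Fin 2) (Fin 2) ℂ)) ∧
        ∀ y : Site (i.1.1.P i.1.2.2) (i.1.2.2 - i.1.2.1), l₀ (embIter (i.1.2.2 - i.1.2.1) y) = cf y) →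
      ∀ a : ℝ, a₀ * (c₀ L / cB L) * ((i.1.1.L : ℝ) ^ (i.1.2.2 - i.1.2.1)) ^ 3 ≤ a → a ≤ a₁ * (c₀ L / cB L) * ((i.1.1.L : ℝ) ^ (i.1.2.2 - i.1.2.1)) ^ 3 →
      ∀ (y : PBond (i.1.1.P i.1.2.1) 0) (Z : Matrix (Fin 2) (Fin 2) ℂ) (b' : Bond 3 (periodsT3 i.1.1 i.1.2.2)),
        ‖NegSup.equiv (levWeight (i.1.1.L : ℝ) (((i.1.1.L : ℝ)⁻¹) ^ (i.1.2.2 - i.1.2.1)) (fun _ : Bond 3 (periodsT3 i.1.1 i.1.2.2) => i.1.2.2 - i.1.2.1) 3) (Matrix (Fin 2) (Fin 2) ℂ)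
            ((currentCLM frobEquiv (fun _ : Bond 3 (periodsT3 i.1.1 i.1.2.2) × Fin 3 => i.1.2.2 - i.1.2.1) (nabla115 (((i.1.1.L : ℝ)⁻¹) ^ (i.1.2.2 - i.1.2.1)) (bgOfCfg i.1.1 i.1.2.2 U₀))
              (DeltaEtaSlot i.1.1 i.1.2.1 i.1.2.2 (c₀ L) U₀)) ((H1f i.1.1 i.1.2.1 i.1.2.2 i.2.2.le (c₀ L) (cB L) a (DeltaPiSlotP i.1.1 i.1.2.1 i.1.2.2 i.2.2.le (c₀ L) (cB L) a) U₀) (Pi.single y Z))) b'‖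
          ≤ CΔ L * Real.exp (-(δΔ L * (Site.tdist (B5Eq118OneStroke.iterBlockOf (i.1.2.2 - i.1.2.1) ((bondEquiv i.1.1 i.1.2.2).symm b').src)
              (T3LevelShift.siteShift (T3PrintedRegularOrbits.sites_eq i.1.1 i.1.2.1 i.1.2.2 i.2.2.le) y.src) : ℝ))) * ‖Z‖ := by
  classical
  obtain ⟨αH, CH, δH, hαH, hWH12, hWH10, hWH13, hαH1, hCH, hδH, hH⟩ := h133_family_exists_allMembers c₀ cB ha₀ ha₀₁
  obtain ⟨αK, c137, δK, hαK, hWK12, hWK10, hWK13, hαK1, hc137, hδK, hK⟩ := h137kpi_family_exists_allMembers c₀ cB ha₀ ha₀₁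
  obtain ⟨αC, C₄, δ₄, hαC, hC₄, hδ₄, hC⟩ := hC4b
  obtain ⟨αcp, γcp, hαcp, hWcp, hwincp, hγcp, hcp⟩ := hco_DeltaPiSlotP_exists c₀ cB ha₀
  -- the common rate and cap
  obtain ⟨δ, hδd⟩ : ∃ δ : ℕ → ℝ, ∀ L, δ L = min (min (δK L) (δH L / 2)) (δ₄ L / 2) := ⟨_, fun _ => rfl⟩
  have hδ0 : ∀ L : ℕ, 1 < L → 0 < δ L := fun L hL => by rw [hδd]; exact lt_min (lt_min (hδK L hL) (half_pos (hδH L hL))) (half_pos (hδ₄ L))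
  have hδK' : ∀ L : ℕ, 1 < L → δ L ≤ δK L := fun L _ => by rw [hδd]; exact (min_le_left _ _).trans (min_le_left _ _)
  have hδH' : ∀ L : ℕ, 1 < L → δ L ≤ δH L / 2 := fun L _ => by rw [hδd]; exact (min_le_left _ _).trans (min_le_right _ _)
  have hδ₄' : ∀ L : ℕ, δ L ≤ δ₄ L / 2 := fun L => by rw [hδd]; exact min_le_right _ _
  obtain ⟨αΔ, hαΔd⟩ : ∃ α : ℕ → ℝ, ∀ L, α L = min (min (min (αH L) (αK L)) (αC L)) (αcp L) := ⟨_, fun _ => rfl⟩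
  have hαΔH : ∀ L, αΔ L ≤ αH L := fun L => by rw [hαΔd]; exact ((min_le_left _ _).trans (min_le_left _ _)).trans (min_le_left _ _)
  have hαΔK : ∀ L, αΔ L ≤ αK L := fun L => by rw [hαΔd]; exact ((min_le_left _ _).trans (min_le_left _ _)).trans (min_le_right _ _)
  have hαΔC : ∀ L, αΔ L ≤ αC L := fun L => by rw [hαΔd]; exact (min_le_left _ _).trans (min_le_right _ _)
  have hαΔcp : ∀ L, αΔ L ≤ αcp L := fun L => by rw [hαΔd]; exact min_le_right _ _
  have hαΔ0 : ∀ L : ℕ, 1 < L → 0 < αΔ L := fun L hL => by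
    rw [hαΔd]; exact lt_min (lt_min (lt_min (hαH L hL) (hαK L hL)) (hαC L hL).1) (hαcp L hL)
  have hW12 : ∀ L : ℕ, 1 < L → 10 ^ 12 * (L : ℝ) ^ 3 * αΔ L ≤ 1 := fun L hL => by
    have hL0 : (0 : ℝ) < L := by exact_mod_cast lt_trans zero_lt_one hL
    exact (mul_le_mul_of_nonneg_left (hαΔH L) (by positivity)).trans (hWH12 L hL)
  have hW10 : ∀ L : ℕ, 1 < L → 10 ^ 10 * (L : ℝ) ^ 6 * αΔ L ≤ 1 := fun L hL => by
    have hL0 : (0 : ℝ) < L := by exact_mod_cast lt_trans zero_lt_one hL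
    exact (mul_le_mul_of_nonneg_left (hαΔH L) (by positivity)).trans (hWH10 L hL)
  have hW13 : ∀ L : ℕ, 1 < L → 13 * 10 ^ 14 * (L : ℝ) ^ 3 * αΔ L ≤ 1 := fun L hL => by
    have hL0 : (0 : ℝ) < L := by exact_mod_cast lt_trans zero_lt_one hL
    exact (mul_le_mul_of_nonneg_left (hαΔH L) (by positivity)).trans (hWH13 L hL)
  -- the weighted (c4) constant at the common rate
  obtain ⟨C₄w, hC₄wd⟩ : ∃ C : ℕ → ℝ, ∀ L, C L = C₄ L * (2 * (1 + 2 / δ₄ L)) ^ 3 := ⟨_, fun _ => rfl⟩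
  have hC₄w0 : ∀ L : ℕ, 1 < L → 0 ≤ C₄w L := fun L hL => by rw [hC₄wd]; have := hC₄ L hL; have := hδ₄ L; positivity
  refine ⟨αΔ, fun L => c137 L + 6 * αΔ L * (1 + Real.exp (4 * δ L)) * C₄w L * CH L, δ, hαΔ0, hW12, hW10, hW13,
    fun L hL => (hαΔH L).trans (hαH1 L hL), fun L hL => by have := hc137 L hL; have := hCH L hL; have := hC₄w0 L hL; have := (hαΔ0 L hL).le; positivity, hδ0, ?_⟩
  intro L hL i U₀ ρ hreg hρ hlift a ha₀a ha₁a y Z b'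
  -- the clamped coupling function
  obtain ⟨af, haf⟩ : ∃ f : ∀ L' : ℕ, Idx L' → ℝ, ∀ (L' : ℕ) (i' : Idx L'),
      f L' i' = max (a₀ * (c₀ L' / cB L') * ((i'.1.1.L : ℝ) ^ (i'.1.2.2 - i'.1.2.1)) ^ 3) (min a (a₁ * (c₀ L' / cB L') * ((i'.1.1.L : ℝ) ^ (i'.1.2.2 - i'.1.2.1)) ^ 3)) :=
    ⟨_, fun _ _ => rfl⟩
  have ht0 : ∀ (L' : ℕ) (i' : Idx L'), 0 ≤ (c₀ L' / cB L') * ((i'.1.1.L : ℝ) ^ (i'.1.2.2 - i'.1.2.1)) ^ 3 := fun L' i' =>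
    mul_nonneg (div_nonneg (hc₀ L').out.le (hcB L').out.le) (pow_nonneg (pow_nonneg (Nat.cast_nonneg _) _) _)
  have haf_lo : ∀ (L' : ℕ) (i' : Idx L'), a₀ * (c₀ L' / cB L') * ((i'.1.1.L : ℝ) ^ (i'.1.2.2 - i'.1.2.1)) ^ 3 ≤ af L' i' := fun L' i' => by rw [haf]; exact le_max_left _ _
  have haf_hi : ∀ (L' : ℕ) (i' : Idx L'), af L' i' ≤ a₁ * (c₀ L' / cB L') * ((i'.1.1.L : ℝ) ^ (i'.1.2.2 - i'.1.2.1)) ^ 3 := fun L' i' => by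
    rw [haf]
    refine max_le ?_ (min_le_right _ _)
    have := ht0 L' i'
    rw [mul_assoc, mul_assoc]; exact mul_le_mul_of_nonneg_right ha₀₁ this
  have hafa : af L i = a := by rw [haf, min_eq_left ha₁a, max_eq_right ha₀a]
  have haf0 : ∀ (L' : ℕ) (i' : Idx L'), 0 ≤ af L' i' := fun L' i' => le_trans (by have := ht0 L' i'; rw [mul_assoc]; positivity) (haf_lo L' i')
  -- the thread `Lift` (no ROOM)
  obtain ⟨Λ, hΛ⟩ : ∃ Λ : ∀ (L' : ℕ) (i' : Idx L'), GaugeField (i'.1.1.P i'.1.2.2) 0 (Matrix.specialUnitaryGroup (Fin 2) ℂ) → Prop, ∀ L' i' U₀', Λ L' i' U₀' ↔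
      (∀ cf : Site (i'.1.1.P i'.1.2.2) (i'.1.2.2 - i'.1.2.1) → Matrix (Fin 2) (Fin 2) ℂ,
        (∀ e' : PBond (i'.1.1.P i'.1.2.2) (i'.1.2.2 - i'.1.2.1), cf e'.src = ((emlIterU (i'.1.2.2 - i'.1.2.1) (bgUnits i'.1.1 i'.1.2.2 U₀') e' : (Matrix (Fin 2) (Fin 2) ℂ)ˣ) : Matrix (Fin 2) (Fin 2) ℂ) * cf e'.tgt *
        (((emlIterU (i'.1.2.2 - i'.1.2.1) (bgUnits i'.1.1 i'.1.2.2 U₀') e')⁻¹ : (Matrix (Fin 2) (Fin 2) ℂ)ˣ) : Matrix (Fin 2) (Fin 2) ℂ)) →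
        ∃ l₀ : Site (i'.1.1.P i'.1.2.2) 0 → Matrix (Fin 2) (Fin 2) ℂ,
        (∀ b' : PBond (i'.1.1.P i'.1.2.2) 0, l₀ b'.src = ((bgUnits i'.1.1 i'.1.2.2 U₀' b' : (Matrix (Fin 2) (Fin 2) ℂ)ˣ) : Matrix (Fin 2) (Fin 2) ℂ) * l₀ b'.tgt * (((bgUnits i'.1.1 i'.1.2.2 U₀' b')⁻¹ : (Matrix (Fin 2) (Fin 2) ℂ)ˣ) : Matrix (Fin 2) (Fin 2) ℂ)) ∧
        ∀ y : Site (i'.1.1.P i'.1.2.2) (i'.1.2.2 - i'.1.2.1), l₀ (embIter (i'.1.2.2 - i'.1.2.1) y) = cf y) := ⟨_, fun _ _ _ => Iff.rfl⟩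
  -- the window of record at each member under the cap (for `posOnto_of_coercive`)
  have hw13 : ∀ (L' : ℕ), 1 < L' → ∀ (i' : Idx L') (ρ' : ℝ), ρ' ≤ αΔ L' → 13 * 10 ^ 14 * (i'.1.1.L : ℝ) ^ 3 * ρ' ≤ 1 := by
    intro L' hL' i' ρ' hρ'
    have e : (i'.1.1.L : ℝ) = (L' : ℝ) := by rw [i'.2.1]
    have hL0 : (0 : ℝ) < L' := by exact_mod_cast lt_trans zero_lt_one hL'
    rw [e]
    calc 13 * 10 ^ 14 * (L' : ℝ) ^ 3 * ρ' ≤ 13 * 10 ^ 14 * (L' : ℝ) ^ 3 * αΔ L' := mul_le_mul_of_nonneg_left hρ' (by positivity)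
      _ ≤ 1 := hW13 L' hL'
  -- the door, BY NAME
  have key := h88_family_of_h137k_h133_c4w αΔ c₀ cB af haf0 Λ
    (fun L' hL' i' U₀' ρ' hreg' hρ' hl' => posOnto_of_coercive i'.2.2.le (cB L') i'.2.2 hreg' (hw13 L' hL' i' ρ' hρ') (hγcp L' hL') _
      (hcp L' hL' i' U₀' ρ' hreg' (hρ'.trans (hαΔcp L')) ((hΛ L' i' U₀').mp hl') (af L' i') (haf_lo L' i')))
    c137 δK CH δH C₄w δ hc137 hCH (fun L' hL' => (hδ0 L' hL').le) hδK' hδH'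
    (fun L' hL' i' U₀' ρ' hreg' hρ' hl' => hK L' hL' i' U₀' ρ' hreg' (hρ'.trans (hαΔK L')) ((hΛ L' i' U₀').mp hl') (af L' i') (haf_lo L' i') (haf_hi L' i'))
    (fun L' hL' i' U₀' ρ' hreg' hρ' hl' => hH L' hL' i' U₀' ρ' hreg' (hρ'.trans (hαΔH L')) ((hΛ L' i' U₀').mp hl') (af L' i') (haf_lo L' i') (haf_hi L' i'))
    (fun L' hL' i' U₀' ρ' hreg' hρ' hl' => by
      have h4 := hc4w_of_hc4b i'.1.1 i'.2.2.le (c₀ L') (cB L') (af L' i') U₀' (hC₄ L' hL') (hδ₄ L') (hδ0 L' hL').le (hδ₄' L')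
        (hC L' hL' i' U₀' ρ' hreg' (hρ'.trans (hαΔC L')) ((hΛ L' i' U₀').mp hl') (af L' i') (haf0 L' i'))
      rw [hC₄wd]
      exact h4)
    L hL i U₀ ρ hreg hρ ((hΛ L i U₀).mpr hlift) y Z b'
  rw [hafa] at key
  exact key


/-- ★★★ **THE S47 ROW `h88` FOR ALL MEMBERS, CLOSED AND ROOM-FREE** — the theorem above fed px5 g15's (C4b) ✓`hc4b_family` at `am := 1`; the S49 socket for row (4)
(thread = rows (1)(3)'s ROOM-free thread: RegPr∕cap, Lift, coupling window). [cite: Balaban1985Variational, (88) p.291, (137)–(138) pp.298–299; Balaban1985BackgroundPropagators, Thm 3.12 p.423] -/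
theorem h88_family_exists_allMembers [hFL : ∀ F : T3Family, Fact (0 < (F.L : ℝ))] [hFη : ∀ (F : T3Family) (k : ℕ), Fact (0 < ((F.L : ℝ)⁻¹) ^ k)]
    (c₀ cB : ℕ → ℝ) [hc₀ : ∀ L : ℕ, Fact (0 < c₀ L)] [hcB : ∀ L : ℕ, Fact (0 < cB L)] {a₀ a₁ : ℝ} (ha₀ : 0 < a₀) (ha₀₁ : a₀ ≤ a₁) :
    ∃ (αΔ CΔ δΔ : ℕ → ℝ),
      (∀ L : ℕ, 1 < L → 0 < αΔ L) ∧ (∀ L : ℕ, 1 < L → 10 ^ 12 * (L : ℝ) ^ 3 * αΔ L ≤ 1) ∧ (∀ L : ℕ, 1 < L → 10 ^ 10 * (L : ℝ) ^ 6 * αΔ L ≤ 1) ∧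
      (∀ L : ℕ, 1 < L → 13 * 10 ^ 14 * (L : ℝ) ^ 3 * αΔ L ≤ 1) ∧ (∀ L : ℕ, 1 < L → αΔ L ≤ 1) ∧ (∀ L : ℕ, 1 < L → 0 ≤ CΔ L) ∧ (∀ L : ℕ, 1 < L → 0 < δΔ L) ∧
    ∀ (L : ℕ), 1 < L → ∀ (i : Idx L) (U₀ : GaugeField (i.1.1.P i.1.2.2) 0 (Matrix.specialUnitaryGroup (Fin 2) ℂ)), ∀ ρ : ℝ, RegPr i.1.1 i.1.2.1 i.1.2.2 ρ U₀ → ρ ≤ αΔ L →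
        (∀ cf : Site (i.1.1.P i.1.2.2) (i.1.2.2 - i.1.2.1) → Matrix (Fin 2) (Fin 2) ℂ,
        (∀ e' : PBond (i.1.1.P i.1.2.2) (i.1.2.2 - i.1.2.1), cf e'.src = ((emlIterU (i.1.2.2 - i.1.2.1) (bgUnits i.1.1 i.1.2.2 U₀) e' : (Matrix (Fin 2) (Fin 2) ℂ)ˣ) : Matrix (Fin 2) (Fin 2) ℂ) * cf e'.tgt *
        (((emlIterU (i.1.2.2 - i.1.2.1) (bgUnits i.1.1 i.1.2.2 U₀) e')⁻¹ : (Matrix (Fin 2) (Fin 2) ℂ)ˣ) : Matrix (Fin 2) (Fin 2) ℂ)) →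
        ∃ l₀ : Site (i.1.1.P i.1.2.2) 0 → Matrix (Fin 2) (Fin 2) ℂ,
        (∀ b' : PBond (i.1.1.P i.1.2.2) 0, l₀ b'.src = ((bgUnits i.1.1 i.1.2.2 U₀ b' : (Matrix (Fin 2) (Fin 2) ℂ)ˣ) : Matrix (Fin 2) (Fin 2) ℂ) * l₀ b'.tgt * (((bgUnits i.1.1 i.1.2.2 U₀ b')⁻¹ : (Matrix (Fin 2) (Fin 2) ℂ)ˣ) : Matrix (Fin 2) (Fin 2) ℂ)) ∧
        ∀ y : Site (i.1.1.P i.1.2.2) (i.1.2.2 - i.1.2.1), l₀ (embIter (i.1.2.2 - i.1.2.1) y) = cf y) →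
      ∀ a : ℝ, a₀ * (c₀ L / cB L) * ((i.1.1.L : ℝ) ^ (i.1.2.2 - i.1.2.1)) ^ 3 ≤ a → a ≤ a₁ * (c₀ L / cB L) * ((i.1.1.L : ℝ) ^ (i.1.2.2 - i.1.2.1)) ^ 3 →
      ∀ (y : PBond (i.1.1.P i.1.2.1) 0) (Z : Matrix (Fin 2) (Fin 2) ℂ) (b' : Bond 3 (periodsT3 i.1.1 i.1.2.2)),
        ‖NegSup.equiv (levWeight (i.1.1.L : ℝ) (((i.1.1.L : ℝ)⁻¹) ^ (i.1.2.2 - i.1.2.1)) (fun _ : Bond 3 (periodsT3 i.1.1 i.1.2.2) => i.1.2.2 - i.1.2.1) 3) (Matrix (Fin 2) (Fin 2) ℂ)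
            ((currentCLM frobEquiv (fun _ : Bond 3 (periodsT3 i.1.1 i.1.2.2) × Fin 3 => i.1.2.2 - i.1.2.1) (nabla115 (((i.1.1.L : ℝ)⁻¹) ^ (i.1.2.2 - i.1.2.1)) (bgOfCfg i.1.1 i.1.2.2 U₀))
              (DeltaEtaSlot i.1.1 i.1.2.1 i.1.2.2 (c₀ L) U₀)) ((H1f i.1.1 i.1.2.1 i.1.2.2 i.2.2.le (c₀ L) (cB L) a (DeltaPiSlotP i.1.1 i.1.2.1 i.1.2.2 i.2.2.le (c₀ L) (cB L) a) U₀) (Pi.single y Z))) b'‖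
          ≤ CΔ L * Real.exp (-(δΔ L * (Site.tdist (B5Eq118OneStroke.iterBlockOf (i.1.2.2 - i.1.2.1) ((bondEquiv i.1.1 i.1.2.2).symm b').src)
              (T3LevelShift.siteShift (T3PrintedRegularOrbits.sites_eq i.1.1 i.1.2.1 i.1.2.2 i.2.2.le) y.src) : ℝ))) * ‖Z‖ :=
  h88_family_exists_allMembers_of_c4bFamily c₀ cB ha₀ ha₀₁ (hc4b_family one_pos c₀ cB)

end Summit.QuantumFields.YangMills.Theorems.Prop7H88FamilyPackageAllMembers

end
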